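import Literature.IUT.HodgeTheaters.PiAvatarOrbitCategory
import Mathlib.GroupTheory.IndexNormal
import HarnessLib

/-!
# The Π-avatar orbit category: inner automorphisms, the index-two involution, conjugation-invariance of the
# index (proof-only sequel of `PiAvatarOrbitCategory.lean`, KIT-INSTANCE-SPEC P5/P1 steps)

S. Mochizuki, *Inter-universal Teichmüller theory I*, kurims manuscript (May 2020), §0 p. 33 (connected
anabelioids `ℬ(Π)⁰`; inner automorphisms induce the identity), Def 4.1 (i) p. 95, Def 6.1 (iii) p. 157 ("natural
surjection `Aut(†𝒟_v) ↠ {±1}`"), (v) p. 158 ("a finite étale double covering `𝒟^{⊚±} → 𝒟^⊚ = ℬ(C_K)⁰`";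
`Aut_K(X_K)` acting on the cusps) ([IUTchI] Def 6.1 (v) p.158) [claim: Mochizuki2012, status: disputed] (D-0012
claim key, series status DISPUTED — GROUP-THEORETIC PLUMBING for the genuine kit instance; nothing of the series
is asserted, no side is taken on [IUTchIII] Cor. 3.12).

Over abc-iut-L5-t4's orbit category `OrbitCat A` (p419432: objects `A/H`, morphisms `xH ↦ xaK`, `Aut(A/H) = N_A(H)/H`):

* `OrbitCat.autOfNormalizer_eq_refl_iff` — the automorphism `xH ↦ xnH` is the identity iff `n ∈ H`; in
  particular INNER automorphisms by elements of `H` act trivially on `ℬ(H)⁰` (KIT-INSTANCE-SPEC P1 at the orbit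
  level: every §6 invariant of `†𝒟_v` read in the Π-avatar factors through `N_A(H)/H`);
* `OrbitCat.autOfNormalizer_trans` — composition of such automorphisms is multiplication in `N_A(H)`;
* `OrbitCat.le_normalizer_of_relIndex_eq_two` + `OrbitCat.exists_involution_of_relIndex_eq_two` — a subgroup of
  index two in an overgroup is normalised by it, and an element of the overgroup outside it induces a NON-TRIVIAL
  INVOLUTIVE automorphism: the shape of Def 6.1 (v)'s double covering `X_K → C_K` (`Π_{X_K} ⊴ Π_{C_K}` of index 2 —
  abc-iut-L5-t1's `PuncturedEllipticData.PiXbar_relIndex_PiCbar = 2` inside abc-iut-L5-t2's `ThetaGeometry`) giving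
  the `±`-involution of `𝒟^{⊚±}`, and of Def 6.1 (iii)'s negative automorphisms (`exists_negative` supplier);
* `OrbitCat.index_eq_of_nonempty_iso` — isomorphic embedded objects (= conjugate subgroups) have the same index in
  the ambient: the degree of the covering is an invariant of the isomorph (sanity law for the kit's `IsLocal`).

Proof-only (no definitions, no `Prop` facts); typed ≠ proved elsewhere.
-/

namespace Literature.IUT.HodgeTheaters

open CategoryTheory

universe u

namespace OrbitCat

variable {A : Type u} [Group A]

/-! ### Inner automorphisms by elements of `H` are trivial on `ℬ(H)⁰` -/

/-- `xH ↦ xnH` is the identity automorphism of `A/H` iff `n ∈ H` ([IUTchI] §0 p.33: inner automorphisms of `Π`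
induce the identity of `ℬ(Π)⁰`; KIT-INSTANCE-SPEC P1 at the orbit level).
([IUTchI] Def 4.1 (i) p.95) [claim: Mochizuki2012, status: disputed] -/
theorem autOfNormalizer_eq_refl_iff {H : Subgroup A} {n : A} (hn : n ∈ Subgroup.normalizer (H : Set A)) :
    autOfNormalizer n hn = Iso.refl (of H) ↔ n ∈ H := by
  constructor
  · intro h
    have h1 := congrArg (fun e : (of H : OrbitCat A) ≅ of H => fn e.hom (QuotientGroup.mk (1 : A))) h
    simp only [fn_autOfNormalizer_hom, one_mul, Iso.refl_hom, fn_id, id_eq] at h1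
    have h2 : n⁻¹ * 1 ∈ H := QuotientGroup.eq.mp h1
    rw [mul_one] at h2
    simpa using H.inv_mem h2
  · intro h
    ext : 1
    apply hom_ext_fn
    funext q
    induction q using Quotient.inductionOn' with
    | h x =>
      change (QuotientGroup.mk (x * n) : A ⧸ H) = QuotientGroup.mk x
      rw [QuotientGroup.eq]
      simpa [mul_inv_rev, mul_assoc] using H.inv_mem h

/-- In particular an element of `H` (e.g. an element of `π₁(†𝒟_v)` itself) induces the identity of `ℬ(H)⁰`.
([IUTchI] Def 4.1 (i) p.95) [claim: Mochizuki2012, status: disputed] -/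
theorem autOfNormalizer_eq_refl_of_mem {H : Subgroup A} {n : A} (h : n ∈ H) :
    autOfNormalizer n (Subgroup.le_normalizer h) = Iso.refl (of H) :=
  (autOfNormalizer_eq_refl_iff _).2 h

/-- Composition of the automorphisms `xH ↦ xnH`, `xH ↦ xmH` is `xH ↦ x(nm)H`: the action of `N_A(H)/H` on `ℬ(H)⁰`
is a (right) group action ([IUTchI] Def 6.1 (v) p.158: `Aut_K(X_K)` as a quotient of a normaliser).
([IUTchI] Def 6.1 (v) p.158) [claim: Mochizuki2012, status: disputed] -/
theorem autOfNormalizer_trans {H : Subgroup A} {n m : A} (hn : n ∈ Subgroup.normalizer (H : Set A))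
    (hm : m ∈ Subgroup.normalizer (H : Set A)) :
    autOfNormalizer n hn ≪≫ autOfNormalizer m hm = autOfNormalizer (n * m) (Subgroup.mul_mem _ hn hm) := by
  ext : 1
  apply hom_ext_fn
  funext q
  induction q using Quotient.inductionOn' with
  | h x =>
    change fn (autOfNormalizer m hm).hom (fn (autOfNormalizer n hn).hom (QuotientGroup.mk x)) =
      (QuotientGroup.mk (x * (n * m)) : A ⧸ H)
    rw [fn_autOfNormalizer_hom, fn_autOfNormalizer_hom, mul_assoc]
    exact rfl

/-! ### The index-two involution (`X_K → C_K`, negative automorphisms) -/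

/-- A subgroup of index two in an overgroup `K` is normalised by `K` (index two ⇒ normal, relative form).
([IUTchI] Def 6.1 (v) p.158) [claim: Mochizuki2012, status: disputed] -/
theorem le_normalizer_of_relIndex_eq_two {H K : Subgroup A} (hHK : H ≤ K) (h2 : H.relIndex K = 2) :
    K ≤ Subgroup.normalizer (H : Set A) := by
  have hN : (H.subgroupOf K).Normal := Subgroup.normal_of_index_eq_two h2
  intro k hk
  rw [Subgroup.mem_normalizer_iff]
  intro x
  constructor
  · intro hx
    have h' := hN.conj_mem ⟨x, hHK hx⟩ (Subgroup.mem_subgroupOf.mpr hx) ⟨k, hk⟩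
    exact Subgroup.mem_subgroupOf.mp h'
  · intro hx
    have hxK : x ∈ K := by
      have h' : k⁻¹ * (k * x * k⁻¹) * k ∈ K := K.mul_mem (K.mul_mem (K.inv_mem hk) (hHK hx)) hk
      simpa [mul_assoc] using h'
    have h' := hN.conj_mem ⟨k * x * k⁻¹, hHK hx⟩ (Subgroup.mem_subgroupOf.mpr hx) ⟨k⁻¹, K.inv_mem hk⟩
    have h'' := Subgroup.mem_subgroupOf.mp h'
    simpa [mul_assoc] using h''

/-- **The index-two involution.** If `H` has index two in `K ≤ A` then some `a ∈ K \ H` induces an automorphism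
`xH ↦ xaH` of `ℬ(H)⁰` that is NOT the identity and squares to the identity — the `±`-involution of the double
covering `𝒟^{⊚±} = ℬ(X_K)⁰ → ℬ(C_K)⁰` ([IUTchI] Def 6.1 (v) p.158), resp. a NEGATIVE automorphism of `†𝒟_v` (Def 6.1
(iii) p.157, the kit field `exists_negative` at the Π-level once cusps are read).
([IUTchI] Def 6.1 (v) p.158) [claim: Mochizuki2012, status: disputed] -/
theorem exists_involution_of_relIndex_eq_two {H K : Subgroup A} (hHK : H ≤ K) (h2 : H.relIndex K = 2) :
    ∃ (a : A) (ha : a ∈ Subgroup.normalizer (H : Set A)), a ∈ K ∧ a ∉ H ∧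
      autOfNormalizer a ha ≠ Iso.refl (of H) ∧
      autOfNormalizer a ha ≪≫ autOfNormalizer a ha = Iso.refl (of H) := by
  obtain ⟨a, haK, haH, -⟩ := Subgroup.relIndex_eq_two_iff_exists_notMem_and.mp h2
  have hn : a ∈ Subgroup.normalizer (H : Set A) := le_normalizer_of_relIndex_eq_two hHK h2 haK
  have haa : a * a ∈ H := by
    have h' := (Subgroup.mul_mem_iff_of_index_two h2 (a := ⟨a, haK⟩) (b := ⟨a, haK⟩)).2 Iff.rfl
    exact Subgroup.mem_subgroupOf.mp h'
  refine ⟨a, hn, haK, haH, fun h => haH ((autOfNormalizer_eq_refl_iff hn).1 h), ?_⟩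
  rw [autOfNormalizer_trans, autOfNormalizer_eq_refl_iff]
  exact haa

/-! ### Conjugate subgroups have the same index -/

/-- Isomorphic embedded objects `A/H ≅ A/K` (⇔ `K = a⁻¹Ha`, `nonempty_iso_iff_conjugate`) have subgroups of the
same index in the ambient — the degree of `ℬ(H)⁰ → ℬ(A)⁰` is an invariant of the isomorph `†𝒟_v` of `𝒟_v`.
([IUTchI] Def 4.1 (i) p.95) [claim: Mochizuki2012, status: disputed] -/
theorem index_eq_of_nonempty_iso {H K : Subgroup A} (h : Nonempty ((of H : OrbitCat A) ≅ of K)) :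
    K.index = H.index := by
  obtain ⟨a, ha⟩ := (nonempty_iso_iff_conjugate H K).1 h
  have hK : K = H.map (MulAut.conj a⁻¹).toMonoidHom := by
    ext x
    rw [Subgroup.mem_map, ha]
    constructor
    · intro hx
      exact ⟨a * x * a⁻¹, hx, by simp [mul_assoc]⟩
    · rintro ⟨y, hy, rfl⟩
      simpa [mul_assoc] using hy
  rw [hK]
  exact Subgroup.index_map_of_bijective (MulAut.conj a⁻¹).bijective H

end OrbitCat

end Literature.IUT.HodgeTheaters
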